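import Mathlib
import Literature.Analysis.ValidatedNumerics.TaylorModelIntegralCertTrig
import Literature.Analysis.ValidatedNumerics.TaylorModelExpr
import Literature.MathematicalPhysics.MHD.CerfonFreidbergSolutions
import Summits.Ventures.FusionMHD.Models.CerfonFreidbergIterLikeQHalfObligation
import Summits.Ventures.FusionMHD.Models.CerfonFreidbergIterLikeAxisTight
import Summits.Ventures.FusionMHD.Models.CerfonFreidbergIterLikeAxis
import Summits.Ventures.FusionMHD.Models.CerfonFreidbergIterLikeShapeCert
import HarnessLib

/-!
# Ventures/FusionMHD — Models/CerfonFreidbergIterLikeQHalfSound.lean: SOUNDNESS of the per-panel kernel obligation of the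
# certified interior `q(ψ_N = 1/2)/F` of THE Cerfon–Freidberg ITER-like instance — what `PanelCert.ok = true` MEANS

HONEST FRAMING (LADDER-GRIDFUSION three columns; CF rung, F2 item R2; `pub/gridfusion/models/F2-SCOPING.md` v1.4 §8(b)/(c)).  The panel
files `…QHalfPanels1…7.lean` decide the Boolean `QHalf.PanelCert.ok` for all 32 panels of `t ∈ [0, 1]` (`θ = π t ∈ [0, π]`).  This file turns
each accepted panel into REAL-NUMBER STATEMENTS about THE instance `U = cfSolution 0 coeff` (`Models/CerfonFreidbergIterLikeAxisCert`):
* §1 generic program lemmas (`runF_append`, `getReg_runF_add`: a block appended to a program runs on the program's final stack; a program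
  pushes exactly `length` registers) — [folklore], Melquiond 2008 §3.3;
* §2 the closed forms `U_X`, `U_Y` of the `α = 0` family and the radial derivative `Drc c X_a s θ = U_X cos θ + U_Y sin θ` at the ray
  point `(X_a + s cos θ, s sin θ)`; **`blockG_regs`**: for ANY stack whose top register is a function `f₀` and whose registers `296…305`
  are the constants `c₀…c₆, X_a, U_a, p`, the block `QHalf.blockG` pushes `U(ray f₀) − U_a/2` (register 110), `Drc` (register 4),
  `X·Drc` (register 3) and `f₀·(X·Drc)⁻¹·p` (top) — symbolic execution (`simp only`) + `ring`;
* §3 `params = [coeff 0, …, coeff 6, X_a, U(X_a, 0), π]` and **`boxMem_params : BoxMem params qbox`** (from `CFIterLike.axZero_tight` —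
  the tight box — and Mathlib's `Real.pi_gt_d20` / `pi_lt_d20`);
* §4 the denotations at THE instance: the APPROXIMANT `mA := progA.toFunP params` (opaque: no closed form is ever used), and
  **`progG_regs`**: the registers of `progG` run on `params` ARE `U(X_a + mA t cos πt, mA t sin πt) − U(X_a,0)/2`, `Drc coeff X_a (mA t) (πt)`,
  the polar `(6.35)` integrand `mA·(X·D_r)⁻¹·π`, and `mA` itself (register 184);
* §5 **`sound_of_ok`**: `PanelCert.ok d = true` ⇒ on panel `d.j` (centre `(2j+1)/64`, half-width `1/64`): the lane's integral segment
  `FSegOK (progG.toFunP params) [1] 2⁶⁰ (2jh) (2(j+1)h) plo phi` (via `fsegOK_of_panelCheckT`), and for `|u| ≤ h` the flux residual at the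
  approximant `|U(ray mA) − U(X_a,0)/2| ≤ eta/2⁶⁰`, `mA ∈ [mlo, mhi]/2⁶⁰`, `D_r(θ, mA) ∈ [dlo, dhi]/2⁶⁰` (via `TProg.stackMem_model` on ALL
  registers + `bounds_of_tmem`).
MODELLED: analytic Cerfon–Freidberg family; `q` of a MODEL surface — nothing about a device or stability.  No `decide` in this file beyond
`rfl`-sized facts; axioms standard.  Typer/prover: gridfusion-model-5 (g7), 2026-08-27.
Citations: Freidberg 2014 §6.3.5 (6.35), §6.6.1 (6.153) [Freidberg2014]; Melquiond 2008 §3.3 [Melquiond2008]; Mahboubi–Melquiond–Sibut-Pinote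
2016 §3.2 Lemma 3, §4.1 [MahboubiMelquiondSibutpinote2016]; Joldes 2011 Alg. 2.2.10 [Joldes2011].
-/

noncomputable section

open Set
open Literature.Analysis.ValidatedNumerics Literature.Analysis.ValidatedNumerics.PolyMP
open Literature.Analysis.ValidatedNumerics.NumericsMP Literature.Analysis.ValidatedNumerics.ExpPoly
open Literature.Analysis.ODE
open Literature.MathematicalPhysics.MHD Literature.MathematicalPhysics.MHD.CerfonFreidberg

namespace Summit.Ventures.FusionMHD.Models.CFIterLike.QHalf

set_option maxRecDepth 100000

/-! ## §1 Generic program lemmas -/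

/-- Running a concatenation = running the second program on the first program's final stack. [folklore] -/
theorem runF_append : ∀ (p q : TProg) (fs : List (ℝ → ℝ)), TProg.runF (p ++ q) fs = TProg.runF q (TProg.runF p fs)
  | [], _, _ => rfl
  | op :: p, q, fs => by
      show TProg.runF (p ++ q) (op.evalF fs :: fs) = TProg.runF q (TProg.runF p (op.evalF fs :: fs))
      exact runF_append p q _

/-- A program pushes exactly `length` registers: below them sits the initial stack. [folklore] -/
theorem getReg_runF_add (d : ℝ → ℝ) : ∀ (p : TProg) (fs : List (ℝ → ℝ)) (i : ℕ),
    getReg d (TProg.runF p fs) (p.length + i) = getReg d fs i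
  | [], fs, i => by simp [TProg.runF]
  | op :: p, fs, i => by
      rw [TProg.runF, List.length_cons, show p.length + 1 + i = p.length + (i + 1) by omega,
        getReg_runF_add d p _ (i + 1), getReg_cons_succ]

/-! ## §2 Closed forms and the symbolic execution of `blockG` -/

/-- `U_X` of the `α = 0` Cerfon–Freidberg family (6.153), written out (`Real.log X` = `ln X`). -/
def UXc (c : Fin 7 → ℝ) (X Y : ℝ) : ℝ :=
  ((2 : ℝ) * c 1 + ((-1) : ℝ) * c 2) * X + (((-2) : ℝ) * c 2) * X * (Real.log X) + (((-8) : ℝ) * c 3 + ((-30) : ℝ) * c 4) * X * Y ^ 2 + (((-24) : ℝ) * c 4) * X * Y ^ 2 * (Real.log X) + ((16 : ℝ) * c 5 + ((-400) : ℝ) * c 6) * X * Y ^ 4 + (((-240) : ℝ) * c 6) * X * Y ^ 4 * (Real.log X) + (((1 : ℝ) / 2) + (4 : ℝ) * c 3 + (3 : ℝ) * c 4) * X ^ 3 + ((12 : ℝ) * c 4) * X ^ 3 * (Real.log X) + (((-48) : ℝ) * c 5 + (480 : ℝ) * c 6) * X ^ 3 * Y ^ 2 + ((720 : ℝ) * c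 6) * X ^ 3 * Y ^ 2 * (Real.log X) + ((6 : ℝ) * c 5 + ((-15) : ℝ) * c 6) * X ^ 5 + (((-90) : ℝ) * c 6) * X ^ 5 * (Real.log X)

/-- `U_Y` of the `α = 0` Cerfon–Freidberg family, written out. -/
def UYc (c : Fin 7 → ℝ) (X Y : ℝ) : ℝ :=
  ((2 : ℝ) * c 2) * Y + ((8 : ℝ) * c 4) * Y ^ 3 + ((48 : ℝ) * c 6) * Y ^ 5 + (((-8) : ℝ) * c 3 + ((-18) : ℝ) * c 4) * X ^ 2 * Y + (((-24) : ℝ) * c 4) * X ^ 2 * Y * (Real.log X) + ((32 : ℝ) * c 5 + ((-560) : ℝ) * c 6) * X ^ 2 * Y ^ 3 + (((-480) : ℝ) * c 6) * X ^ 2 * Y ^ 3 * (Real.log X) + (((-24) : ℝ) * c 5 + (150 : ℝ) * c 6) * X ^ 4 * Y + ((360 : ℝ) * c 6) * X ^ 4 * Y * (Real.log X)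

/-- The RADIAL DERIVATIVE field `D_r(θ, s) = U_X cos θ + U_Y sin θ` at the ray point `(X_a + s cos θ, s sin θ)`. -/
def Drc (c : Fin 7 → ℝ) (Xa s θ : ℝ) : ℝ :=
  UXc c (Xa + s * Real.cos θ) (s * Real.sin θ) * Real.cos θ + UYc c (Xa + s * Real.cos θ) (s * Real.sin θ) * Real.sin θ

/-- **SYMBOLIC EXECUTION OF `blockG`.**  For any stack `stk` with top register `f₀` and the ten constants `c₀…c₆, X_a, U_a, p` at
depths `296…305`: register 110 of `blockG`'s run is the flux residual `U(X_a + f₀ cos pt, f₀ sin pt) − U_a/2`, register 4 is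
`Drc c X_a (f₀ t) (p t)`, register 3 is `X · (register 4)` and the top register is `f₀ · (register 3)⁻¹ · p`. -/
theorem blockG_regs (stk : List (ℝ → ℝ)) (c : Fin 7 → ℝ) (Xa Ua p : ℝ) (f0 : ℝ → ℝ)
    (h0 : getReg (fun _ => (0 : ℝ)) stk 0 = f0)
    (hc0 : getReg (fun _ => (0 : ℝ)) stk 296 = fun _ => c 0)
    (hc1 : getReg (fun _ => (0 : ℝ)) stk 297 = fun _ => c 1)
    (hc2 : getReg (fun _ => (0 : ℝ)) stk 298 = fun _ => c 2)
    (hc3 : getReg (fun _ => (0 : ℝ)) stk 299 = fun _ => c 3)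
    (hc4 : getReg (fun _ => (0 : ℝ)) stk 300 = fun _ => c 4)
    (hc5 : getReg (fun _ => (0 : ℝ)) stk 301 = fun _ => c 5)
    (hc6 : getReg (fun _ => (0 : ℝ)) stk 302 = fun _ => c 6)
    (hXa : getReg (fun _ => (0 : ℝ)) stk 303 = fun _ => Xa)
    (hUa : getReg (fun _ => (0 : ℝ)) stk 304 = fun _ => Ua)
    (hp : getReg (fun _ => (0 : ℝ)) stk 305 = fun _ => p)
    (t : ℝ) :
    getReg (fun _ => (0 : ℝ)) (TProg.runF blockG stk) 110 t
        = cfSolution 0 c (Xa + f0 t * Real.cos (p * t)) (f0 t * Real.sin (p * t)) - 1 / 2 * Ua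
    ∧ getReg (fun _ => (0 : ℝ)) (TProg.runF blockG stk) 4 t = Drc c Xa (f0 t) (p * t)
    ∧ getReg (fun _ => (0 : ℝ)) (TProg.runF blockG stk) 3 t
        = (Xa + f0 t * Real.cos (p * t)) * getReg (fun _ => (0 : ℝ)) (TProg.runF blockG stk) 4 t
    ∧ getReg (fun _ => (0 : ℝ)) (TProg.runF blockG stk) 0 t
        = f0 t * (getReg (fun _ => (0 : ℝ)) (TProg.runF blockG stk) 3 t)⁻¹ * p := by
  simp only [blockG, TProg.runF, TOp.evalF, SOp.evalF, getReg_cons_zero, getReg_cons_succ, h0, hc0, hc1, hc2, hc3, hc4, hc5,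
    hc6, hXa, hUa, hp, Poly.eval_cons, Poly.eval_nil, Rat.cast_zero, Rat.cast_one, zero_add, add_zero, mul_one, mul_zero]
  refine ⟨?_, ?_, ?_, ?_⟩
  · simp only [cfSolution, UP, U0, U1, U2, U3, U4, U5, U6]; push_cast; ring
  · simp only [Drc, UXc, UYc]; push_cast; ring
  · trivial
  · trivial

/-! ## §3 The parameters of THE instance and their box -/

/-- The parameter vector of THE instance: `c₀…c₆` (= `coeff`), `X_a`, `U(X_a, 0)`, `π`. -/
def params : List ℝ := [coeff 0, coeff 1, coeff 2, coeff 3, coeff 4, coeff 5, coeff 6, Xa, U Xa 0, Real.pi]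

/-- **THE PARAMETERS LIE IN THE BOX `qbox`** (coordinates 0–6, 8, 17 of `tightBox`; `π` by Mathlib's 20-digit bounds). -/
theorem boxMem_params : BoxMem params qbox := by
  have h0 := axZero_tight 0; have h1 := axZero_tight 1; have h2 := axZero_tight 2; have h3 := axZero_tight 3
  have h4 := axZero_tight 4; have h5 := axZero_tight 5; have h6 := axZero_tight 6; have h8 := axZero_tight 8
  have h17 := axZero_tight 17
  obtain ⟨e0, e1, e2, e3, e4, e5, e6⟩ := coeff_eq_axZero
  have eX : Xa = axZero 8 := rfl
  have eU : U Xa 0 = axZero 17 := U_axis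
  have hpi1 := Real.pi_gt_d20; have hpi2 := Real.pi_lt_d20
  simp only [tightBox, Matrix.cons_val] at h0 h1 h2 h3 h4 h5 h6 h8 h17
  push_cast at h0 h1 h2 h3 h4 h5 h6 h8 h17
  unfold params qbox
  rw [e0, e1, e2, e3, e4, e5, e6, eU, eX]
  refine boxMem_cons ?_ ?_ (boxMem_cons ?_ ?_ (boxMem_cons ?_ ?_ (boxMem_cons ?_ ?_ (boxMem_cons ?_ ?_ (boxMem_cons ?_ ?_
    (boxMem_cons ?_ ?_ (boxMem_cons ?_ ?_ (boxMem_cons ?_ ?_ (boxMem_cons ?_ ?_ boxMem_nil)))))))))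
  all_goals push_cast
  all_goals
    linarith [h0.1, h0.2, h1.1, h1.2, h2.1, h2.2, h3.1, h3.2, h4.1, h4.2, h5.1, h5.2, h6.1, h6.2, h8.1, h8.2, h17.1, h17.2]

/-! ## §4 Denotations at THE instance -/

/-- **THE APPROXIMANT** `m(t)`: the top register of `progA` run on the instance parameters (the in-program chord-Newton ray radius of
the surface `ψ_N = 1/2` in direction `θ = π t`).  OPAQUE: nothing below uses a formula for it. -/
def mA : ℝ → ℝ := progA.toFunP params

/-- The final stack of `progA` on the instance parameters. -/
def stkA : List (ℝ → ℝ) := TProg.runF progA (constStack params)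

/-- `progA` has 296 statements. -/
theorem progA_length : progA.length = 296 := by decide

/-- `blockG` has 184 statements. -/
theorem blockG_length : blockG.length = 184 := by decide

/-- The top register of `stkA` is `mA`. -/
theorem stkA_top : getReg (fun _ => (0 : ℝ)) stkA 0 = mA := rfl

/-- Below `progA`'s 296 pushes sit the constants. -/
theorem stkA_param (i : ℕ) : getReg (fun _ => (0 : ℝ)) stkA (296 + i) = getReg (fun _ => (0 : ℝ)) (constStack params) i := by
  rw [stkA, ← progA_length]; exact getReg_runF_add _ progA _ i

/-- **THE REGISTERS OF `progG` AT THE INSTANCE**: residual, radial derivative, the polar `(6.35)` integrand times `π`, and `mA`. -/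
theorem progG_regs (t : ℝ) :
    getReg (fun _ => (0 : ℝ)) (TProg.runF progG (constStack params)) idxF t
        = U (Xa + mA t * Real.cos (Real.pi * t)) (mA t * Real.sin (Real.pi * t)) - 1 / 2 * U Xa 0
    ∧ getReg (fun _ => (0 : ℝ)) (TProg.runF progG (constStack params)) idxD t = Drc coeff Xa (mA t) (Real.pi * t)
    ∧ getReg (fun _ => (0 : ℝ)) (TProg.runF progG (constStack params)) 0 t
        = mA t * ((Xa + mA t * Real.cos (Real.pi * t)) * Drc coeff Xa (mA t) (Real.pi * t))⁻¹ * Real.pi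
    ∧ getReg (fun _ => (0 : ℝ)) (TProg.runF progG (constStack params)) idxM t = mA t := by
  have hrun : TProg.runF progG (constStack params) = TProg.runF blockG stkA := by rw [progG, runF_append]; rfl
  rw [hrun]
  have hP : ∀ i, getReg (fun _ => (0 : ℝ)) stkA (296 + i) = getReg (fun _ => (0 : ℝ)) (constStack params) i := stkA_param
  have h := blockG_regs stkA coeff Xa (U Xa 0) Real.pi mA stkA_top
    (by rw [hP 0]; simp [constStack, params]) (by rw [hP 1]; simp [constStack, params]) (by rw [hP 2]; simp [constStack, params])
    (by rw [hP 3]; simp [constStack, params]) (by rw [hP 4]; simp [constStack, params]) (by rw [hP 5]; simp [constStack, params])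
    (by rw [hP 6]; simp [constStack, params]) (by rw [hP 7]; simp [constStack, params]) (by rw [hP 8]; simp [constStack, params])
    (by rw [hP 9]; simp [constStack, params]) t
  obtain ⟨hF, h4, h3, h0⟩ := h
  refine ⟨?_, ?_, ?_, ?_⟩
  · rw [show idxF = 110 from rfl, hF]; rfl
  · rw [show idxD = 4 from rfl, h4]
  · rw [h0, h3, h4]
  · rw [show idxM = 184 from rfl, show (184 : ℕ) = blockG.length + 0 by rw [blockG_length], getReg_runF_add, stkA_top]

/-! ## §5 Soundness of the per-panel obligation -/

/-- `0 < S`. -/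
theorem tmS_pos : 0 < tmS := by norm_num [tmS]
/-- `0 < h`. -/
theorem hw_pos : (0 : ℚ) < hw := by norm_num [hw]

/-- The flux RESIDUAL of the approximant: `U(X_a + m cos θ, m sin θ) − U(X_a, 0)/2` at `θ = π t`. -/
def resid (t : ℝ) : ℝ := U (Xa + mA t * Real.cos (Real.pi * t)) (mA t * Real.sin (Real.pi * t)) - 1 / 2 * U Xa 0

/-- The radial derivative ALONG THE APPROXIMANT: `D_r(π t, m t)`. -/
def DrA (t : ℝ) : ℝ := Drc coeff Xa (mA t) (Real.pi * t)

/-- From scaled-integer range claims to real bounds on a register (via `bounds_of_tmem`). -/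
theorem reg_bounds {j i : ℕ} {W : IPoly} {lo hi : ℤ}
    (hW : TMem tmS hw (fun u => getReg (fun _ => (0 : ℝ)) (TProg.runF progG (constStack params)) i ((ctr j : ℝ) + u)) W)
    (hlo : lo ≤ tlowerI tmS hw W) (hhi : tupperI tmS hw W ≤ hi) {u : ℝ} (hu : |u| ≤ hw) :
    ((lo : ℝ) / tmS) ≤ getReg (fun _ => (0 : ℝ)) (TProg.runF progG (constStack params)) i ((ctr j : ℝ) + u)
      ∧ getReg (fun _ => (0 : ℝ)) (TProg.runF progG (constStack params)) i ((ctr j : ℝ) + u) ≤ ((hi : ℝ) / tmS) := by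
  have hS : ((tmS : ℕ) : ℚ) ≠ 0 := by exact_mod_cast tmS_pos.ne'
  have h := bounds_of_tmem tmS_pos hw_pos.le hW (lo := (lo : ℚ) / tmS) (hi := (hi : ℚ) / tmS)
    (by rw [div_mul_cancel₀ _ hS]; exact_mod_cast hlo) (by rw [div_mul_cancel₀ _ hS]; exact_mod_cast hhi) hu
  push_cast at h
  exact h

/-- Panel centres agree: the lane's `panelCentre h j` is `ctr j`. -/
theorem pc_eq (j : ℕ) : panelCentre hw j = ctr j := rfl

/-- The lane's per-panel check from its parts, for an ABSTRACT program (so that no kernel object is ever unfolded). -/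
theorem panelCheckT_of_parts {S : ℕ} {h : ℚ} {D K Ke ke Kl Kt kt : ℕ} {p : TProg} {B : PBox} {q : Poly} {j : ℕ}
    {cs : List (List ℤ × ℕ)} {plo phi : ℤ} (hS : 0 < S) (hh : 0 < h)
    (hok : (p.model S h D K Ke ke Kl Kt kt (panelCentre h j) (constModels S B) cs).2 = true)
    (hlo : plo ≤ (panelIntegI S h (getReg [] (p.model S h D K Ke ke Kl Kt kt (panelCentre h j) (constModels S B) cs).1 0)
        (midPoly S (getReg [] (p.model S h D K Ke ke Kl Kt kt (panelCentre h j) (constModels S B) cs).1 0)) (recenter q h j)).lo)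
    (hhi : (panelIntegI S h (getReg [] (p.model S h D K Ke ke Kl Kt kt (panelCentre h j) (constModels S B) cs).1 0)
        (midPoly S (getReg [] (p.model S h D K Ke ke Kl Kt kt (panelCentre h j) (constModels S B) cs).1 0)) (recenter q h j)).hi
        ≤ phi) :
    panelCheckT S h D K Ke ke Kl Kt kt p B q j cs plo phi = true := by
  unfold panelCheckT TProg.pmodelP
  simp only [Bool.and_eq_true, decide_eq_true_eq]
  exact ⟨⟨⟨⟨hS, hh⟩, hok⟩, hlo⟩, hhi⟩

/-- **SOUNDNESS OF `PanelCert.ok`.**  If the kernel accepts panel `d.j`, then (i) the lane's integral segment of the polar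
integrand program holds with the claimed bounds, and for every `|u| ≤ h`, at `t = (2j+1)h + u`: (ii) `|resid t| ≤ eta/2⁶⁰`,
(iii) `mA t ∈ [mlo, mhi]/2⁶⁰`, (iv) `DrA t ∈ [dlo, dhi]/2⁶⁰`. -/
theorem sound_of_ok {d : PanelCert} (h : d.ok = true) :
    FSegOK (progG.toFunP params) [1] tmS (panelLeft hw d.j) (panelLeft hw (d.j + 1)) d.plo d.phi
    ∧ (∀ u : ℝ, |u| ≤ hw → |resid ((ctr d.j : ℝ) + u)| ≤ (d.eta : ℝ) / tmS)
    ∧ (∀ u : ℝ, |u| ≤ hw → ((d.mlo : ℝ) / tmS) ≤ mA ((ctr d.j : ℝ) + u) ∧ mA ((ctr d.j : ℝ) + u) ≤ ((d.mhi : ℝ) / tmS))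
    ∧ (∀ u : ℝ, |u| ≤ hw → ((d.dlo : ℝ) / tmS) ≤ DrA ((ctr d.j : ℝ) + u) ∧ DrA ((ctr d.j : ℝ) + u) ≤ ((d.dhi : ℝ) / tmS)) := by
  simp only [PanelCert.ok, PanelData.ok, Bool.and_eq_true, decide_eq_true_eq] at h
  obtain ⟨⟨⟨⟨⟨⟨⟨⟨hok, hplo⟩, hphi⟩, hFlo⟩, hFhi⟩, hmlo⟩, hmhi⟩, hdlo⟩, hdhi⟩ := h
  unfold panelModels at hok hplo hphi hFlo hFhi hmlo hmhi hdlo hdhi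
  have hst := TProg.stackMem_model tmS_pos hw_pos.le (ctr d.j) progG (stackMem_const tmS hw (ctr d.j) boxMem_params) _ hok
  rw [← pc_eq] at hok hplo hphi
  refine ⟨fsegOK_of_panelCheckT (panelCheckT_of_parts tmS_pos hw_pos hok hplo hphi) boxMem_params, ?_, ?_, ?_⟩
  · intro u hu
    have hb := reg_bounds (hst idxF) hFlo hFhi hu
    rw [(progG_regs _).1] at hb
    rw [resid, abs_le]
    push_cast at hb
    rw [neg_div] at hb
    exact hb
  · intro u hu
    have hb := reg_bounds (hst idxM) hmlo hmhi hu
    rwa [(progG_regs _).2.2.2] at hb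
  · intro u hu
    have hb := reg_bounds (hst idxD) hdlo hdhi hu
    rw [(progG_regs _).2.1] at hb
    exact hb

/-- **The integrand certified by the integral segment IS the polar `(6.35)` integrand along the approximant, times `π`.** -/
theorem progG_toFunP (t : ℝ) :
    progG.toFunP params t = mA t * ((Xa + mA t * Real.cos (Real.pi * t)) * DrA t)⁻¹ * Real.pi := by
  unfold TProg.toFunP
  rw [(progG_regs t).2.2.1]
  rfl

end Summit.Ventures.FusionMHD.Models.CFIterLike.QHalf

end
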